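import Summits.KontsevichZagierPeriods.KontsevichZagierPeriods.Theses.UnfoldedStokes
import Summits.KontsevichZagierPeriods.KontsevichZagierPeriods.Theorems.UnfoldedStokesStokesGenerationLineReduction
import Literature.NumberTheory.Transcendental.KZSemiCanonicalReductionProofs
import Literature.NumberTheory.Transcendental.KZCalculusProofs
import Mathlib.Analysis.Normed.Group.Bounded

/-!
# `StokesGenerationOfPieces` (stmt-KontsevichZagierPeriods-17862): the split glue of the deciding crux

Route `KontsevichZagierPeriods/UnfoldedStokes`, support item `StokesGenerationOfPieces`:

  `ContinuousCubification → PlanarAreas → CubeKernelStep → StokesGeneration`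

(with `PlanarAreas` inlined verbatim in the route decl). The proof is an interleaved induction on the
dimension of a closed-cube representation `[[0,1]^M, h]` with `h` continuous on the closed cube and
value `0` ("continuous cube kernel element"):

* layer `1` from `PlanarAreas`: `h` is bounded on the compact cube, so `[t] ≡ [A] − [B]` with `A, B`
  bounded planar sets of integrand `1` (Viu-Sos' region under the graph,
  `KZ.exists_sub_of_isBounded`); by soundness (`KZ.relations_le_ker_eval_holds`) `area A = area B`,
  and `PlanarAreas` makes `[A] − [B]`, hence `[t]`, a relation;
* layer `0` by lifting to dimension `1` inside the moves (`StokesGenerationLine.exists_liftCube`);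
* layer `d + 1`, `d ≥ 1`, by `CubeKernelStep` from all layers `≤ d` (strong induction);
* the crux: `x ∈ ker eval` is congruent to one continuous closed-cube representation
  (`ContinuousCubification`), of value `0` by soundness, a relation by the induction; so
  `x ∈ relations ≤ relations ⊔ closure S`.

No definition is introduced: the "layer `M`" property is written out as the hypothesis shape of
`CubeKernelStep`. References: Kontsevich–Zagier 2001 §1.2; Viu-Sos 2021 Cor. 2.3; Ayoub 2015 Rem. 1.2.
-/

noncomputable section

namespace Summit.KontsevichZagierPeriods.UnfoldedStokes

open MeasureTheory Set
open Literature.NumberTheory.Transcendental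
open Literature.NumberTheory.Transcendental.KZ
open Summit.KontsevichZagierPeriods.KontsevichZagierPeriods.Theses.UnfoldedStokes
  (StokesGeneration ContinuousCubification CubeKernelStep StokesGenerationOfPieces)
open Summit.KontsevichZagierPeriods.KontsevichZagierPeriods.StokesGenerationLine (exists_liftCube)

namespace StokesGenerationOfPieces

/-- Soundness in the form used here: if `x - y` is a relation then `eval x = eval y`.
[cite: KontsevichZagier2001, §1.2] -/
theorem eval_eq_of_sub_mem_relations {x y : FormalRep} (h : x - y ∈ relations) :
    eval x = eval y := by
  have h0 : eval (x - y) = 0 := relations_le_ker_eval_holds h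
  rwa [map_sub, sub_eq_zero] at h0

/-- **Layer 1 from `PlanarAreas`.** A closed-interval representation `[[0,1], h]` with `h` continuous
and `∫ h = 0` is a relation, granted that equal-area planar sets of integrand `1` are KZ-equivalent:
`[t] ≡ [A] − [B]` (Viu-Sos' region under the graph of the sign pieces of the bounded `h`), the areas
agree by soundness, and `PlanarAreas` closes. [cite: ViuSos2021, Cor. 2.3] -/
theorem cubeKernel_one
    (hP : ∀ (r r' : IntegralRep 2), (∀ p ∈ r.domain, r.integrand p = 1) →
      (∀ p ∈ r'.domain, r'.integrand p = 1) → r.value = r'.value → Equivalent r r')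
    (t : IntegralRep 1) (ht : t.domain = Set.pi Set.univ (fun _ : Fin 1 => Set.Icc (0:ℝ) 1))
    (hc : ContinuousOn t.integrand t.domain) (hv : t.value = 0) : of t ∈ relations := by
  have hK : IsCompact t.domain := ht ▸ isCompact_univ_pi fun _ => isCompact_Icc
  obtain ⟨C, hC⟩ := hK.exists_bound_of_continuousOn hc
  have hM : ∀ x ∈ t.domain, |t.integrand x| ≤ C := fun x hx => by
    simpa [Real.norm_eq_abs] using hC x hx
  obtain ⟨A, B, -, -, hA1, hB1, hrel⟩ := exists_sub_of_isBounded t hK.isBounded hM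
  have hval : A.value = B.value := by
    have h1 := eval_eq_of_sub_mem_relations hrel
    rw [map_sub, eval_of, eval_of, eval_of, hv] at h1
    linarith
  have hAB : of A - of B ∈ relations := hP A B hA1 hB1 hval
  have e : of t = (of t - (of A - of B)) + (of A - of B) := by abel
  rw [e]
  exact relations.add_mem hrel hAB

/-- **Layer 0 from layer 1.** A point representation of value `0` is a relation once layer `1` is:
lift `[pt, c]` to `[[0,1], c]` inside the moves (`exists_liftCube`), whose integrand is again
continuous on the closed cube and whose value is again `0` by soundness.
[cite: KontsevichZagier2001, §1.2 rule (3)] -/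
theorem cubeKernel_zero
    (h1 : ∀ t : IntegralRep 1, t.domain = Set.pi Set.univ (fun _ : Fin 1 => Set.Icc (0:ℝ) 1) →
      ContinuousOn t.integrand t.domain → t.value = 0 → of t ∈ relations)
    (t : IntegralRep 0) (ht : t.domain = Set.pi Set.univ (fun _ : Fin 0 => Set.Icc (0:ℝ) 1))
    (hc : ContinuousOn t.integrand t.domain) (hv : t.value = 0) : of t ∈ relations := by
  obtain ⟨t', ht'd, ht'i, hrel⟩ := exists_liftCube 0 1 (Nat.zero_le 1) t ht
  have hc' : ContinuousOn t'.integrand t'.domain := by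
    rw [ht'd]
    have hcomp : ContinuousOn
        (fun x : Fin 1 → ℝ => t.integrand (fun l => x (Fin.castLE (Nat.zero_le 1) l)))
        (Set.pi Set.univ (fun _ : Fin 1 => Set.Icc (0:ℝ) 1)) := by
      refine hc.comp (Continuous.continuousOn (by fun_prop)) fun x hx => ?_
      rw [ht]
      exact fun l _ => hx (Fin.castLE (Nat.zero_le 1) l) (Set.mem_univ _)
    exact hcomp.congr fun x hx => ht'i x hx
  have hv' : t'.value = 0 := by
    have h := eval_eq_of_sub_mem_relations hrel
    rw [eval_of, eval_of, hv] at h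
    exact h.symm
  have ht' : of t' ∈ relations := h1 t' ht'd hc' hv'
  have e : of t = (of t - of t') + of t' := by abel
  rw [e]
  exact relations.add_mem hrel ht'

/-- **All layers.** From layer `1` (hence layer `0`, `cubeKernel_zero`) and the step `CubeKernelStep`
(every layer `≤ d` gives layer `d + 1`, for `d ≥ 1`), every layer holds, by strong induction on the
dimension. [cite: Ayoub2015, Rem. 1.2] -/
theorem cubeKernel_all
    (h1 : ∀ t : IntegralRep 1, t.domain = Set.pi Set.univ (fun _ : Fin 1 => Set.Icc (0:ℝ) 1) →
      ContinuousOn t.integrand t.domain → t.value = 0 → of t ∈ relations)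
    (hS : CubeKernelStep) (M : ℕ) (t : IntegralRep M)
    (ht : t.domain = Set.pi Set.univ (fun _ : Fin M => Set.Icc (0:ℝ) 1))
    (hc : ContinuousOn t.integrand t.domain) (hv : t.value = 0) : of t ∈ relations := by
  have key : ∀ d M, M ≤ d → ∀ t : IntegralRep M,
      t.domain = Set.pi Set.univ (fun _ : Fin M => Set.Icc (0:ℝ) 1) →
      ContinuousOn t.integrand t.domain → t.value = 0 → of t ∈ relations := by
    intro d
    induction d with
    | zero =>
      intro M hM
      obtain rfl : M = 0 := Nat.le_zero.mp hM
      exact cubeKernel_zero h1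
    | succ d ih =>
      intro M hM
      rcases Nat.lt_or_ge M (d + 1) with hlt | hge
      · exact ih M (Nat.lt_succ_iff.mp hlt)
      · obtain rfl : M = d + 1 := le_antisymm hM hge
        rcases Nat.eq_zero_or_pos d with rfl | hd
        · exact h1
        · exact hS d hd ih
  exact key M M le_rfl t ht hc hv

end StokesGenerationOfPieces

open StokesGenerationOfPieces in
/-- **`StokesGenerationOfPieces` holds** (stmt-KontsevichZagierPeriods-17862): continuous
cubification modulo the moves, equal-area planar sets being KZ-equivalent (`PlanarAreas`, inlined),
and the dimension step `CubeKernelStep` together give Stokes generation of `ker eval`. A kernel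
element `x` is congruent to one continuous closed-cube representation `t` (cubification), whose
value is `0` by soundness; `[t]` is a relation by the induction `cubeKernel_all`; hence
`x = (x − [t]) + [t] ∈ relations ≤ relations ⊔ closure S`.
[cite: KontsevichZagier2001, §1.2] -/
theorem stokesGenerationOfPieces_proof : StokesGenerationOfPieces := by
  intro hC hP hS x hx
  obtain ⟨M, t, htd, htc, hxt⟩ := hC x
  have hval : t.value = 0 := by
    have h := eval_eq_of_sub_mem_relations hxt
    rw [eval_of, hx] at h
    exact h.symm
  have ht : of t ∈ relations := cubeKernel_all (cubeKernel_one hP) hS M t htd htc hval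
  have hxr : x ∈ relations := by
    have e : x = (x - of t) + of t := by abel
    rw [e]
    exact relations.add_mem hxt ht
  exact AddSubgroup.mem_sup_left hxr

end Summit.KontsevichZagierPeriods.UnfoldedStokes
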